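import Summits.ABC.IUTFork.Conditional.WRowLicenceSocketMOfK
import Summits.ABC.IUTFork.Conditional.AbcOfSGenuineKWildInhabitedRow73Unconditional
import HarnessLib

/-!
# Branch C / R-W, reading (U), M line: the M-SETTING twin of the HAND-BUILT kernel INHABITED theorem `WRow.licence_frey73_l73_unconditional`
# (`Conditional/AbcOfSGenuineKWildInhabitedRow73Unconditional`; point `ratPoint (73 / 5973865915867209)`; binders `—`)
# (abc-iut cell, branch C, row «C:INH-M-TWIN-RESIDUE»; seat abc-iut-C-cert-2 gen 8; C LEAD KEY 2026-08-27T13:11Z; work list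
# abc-iut-rw-num-lead's `plan/rescue/R-W/M-TWIN-GAP-INH.tsv`)

Record-only PROOF file (D-0012; 0 definitions, 0 `Prop` facts, nothing re-typed) of the abc-iut cell. TAKES NO SIDE on [IUTchIII] Cor. 3.12
(S. Mochizuki, *Inter-universal Teichmüller theory III*, Cor. 3.12 p. 173–174; Step (xi-f) p. 184) or on any author; «inhabited as typed» ≠
«asserted in print».

The K theorem is HAND-BUILT over abc-iut-w4-d036's K orders socket `Cor312Prov.licence_settingPrVolSharp_pilotDataOfK_of_orders_rat`: its
proof names per-prime integers `(e, D, h, ρin, ρout)` and discharges a LOCAL PACKAGE at every bad K-fibre point and the integer CELLS at every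
label (the W lane's lemmas, credited in the K file, all BY NAME here). This seat's transfer socket `WRowM.licence_tOfIdeleData_of_ordersK_rat`
(`WRowLicenceSocketMOfK`, gen 8) takes THE SAME two hypothesis functions — so the M twin below is the K proof by SURGERY (generator
`tools/gen_handbuilt_m.py`): conclusion binders ↦ the M-level ones, `intro` line ↦ the M context, final `refine` ↦ the transfer socket (the
K socket's `hiso` argument dropped); EVERY per-prime package line and EVERY cell line is the K file's, VERBATIM (no number re-derived; the
K file's arithmetic certificates and shape lemmas BY NAME through the import). Conclusion = `Thm311ToCor312.Licence` at the M-LEVEL setting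
of the datum's own ideles `settingPrVolSharpM T.D hlog (tOfIdeleData T.D r) (tqM … r …) …` for EVERY idele datum `r`, every analytic
`logvK`, any `htq0/Sq/htq1` — the setting of the M books of record (`abc_of_SH_v11M_window_content` p461893 and its Szpiro-bad / stable
companions), whose (U) binder therefore reads INHABITED AS TYPED where the K theorem says.

* **`WRowM.licence_frey73_l73_unconditional_M`** — M twin of `WRow.licence_frey73_l73_unconditional` (binders VERBATIM).

HONEST SCOPE: OUR sharp containers and Dupuy–Hilado's typed (Ind1)/(Ind2); STRONGER-THAN-PRINT hull reading; a socket discharges nothing;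
non-emptiness of the datum type, admissibility and Szpiro-badness NOT claimed; explicit hypothesis counts of the record books UNCHANGED; an M
twin changes NO K-line census count; nothing about the printed GLOBAL inequality or the number-level corollary; typed ≠ proved; instantiated ≠
endorsed; no abc claim. [cite: Mochizuki2012, IUTchI Def. 3.1 (b),(c) pp. 61–62, Rmk. 3.1.5 p. 65, Ex. 3.2 (iv) p. 71; IUTchIII Cor. 3.12
Step (xi-f) p. 184; IUTchIV Prop. 1.1 p. 9, Prop. 1.2 (i)(ii) p. 10, Prop. 1.4 (ii) p. 13, Cor. 2.2 (ii) proof (P5) p. 46]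
[cite: DupuyHilado2025, §3.3, §3.4, §4.9, §4.12] [cite: NeukirchANT1999, Ch. II (5.5)–(5.7)] [cite: SilvermanAEC2009, Prop. III.1.7(b)]
[claim: Mochizuki2012, status: disputed] for every IUT sentence. PROOF-ONLY: no definitions.
-/

noncomputable section

open Set Function Metric NumberField IsDedekindDomain

namespace Summit.ABC.IUTFork.Conditional

open Thm311 Thm311.Real Cor312 Cor312Vol Cor312Prov Literature.IUT.LogThetaLattice Literature.IUT.LogVolume
  Literature.IUT.HodgeTheaters Literature.IUT.LogVolume.Cor22
open Literature.NumberTheory.NumberFields Literature.NumberTheory.GaloisRepresentations.Ultrametric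
open Literature.NumberTheory.DiophantineGeometry Literature.NumberTheory.DiophantineGeometry.GenEll

/-- **M TWIN of `WRow.licence_frey73_l73_unconditional`** (`Conditional/AbcOfSGenuineKWildInhabitedRow73Unconditional`; binders `—` VERBATIM): for EVERY genuine Θ-volume datum `T` at `ratPoint (73 / 5973865915867209)` (level as bound)
and EVERY idele datum `r` of `T.D`, `Thm311ToCor312.Licence` at the M-LEVEL setting `settingPrVolSharpM T.D hlog (tOfIdeleData T.D r) (tqM … r …) …` —
the K file's per-prime packages and cells VERBATIM, fed to this seat's transfer socket `WRowM.licence_tOfIdeleData_of_ordersK_rat`. The M books'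
(U) binder is INHABITED AS TYPED there. K docstring, for the record: «**W1 ROW 6 DECISION, INHABITED SIDE, UNCONDITIONAL — `73 + 2¹³·7⁷·941² = 3¹⁶·103³·127` at `l = 73`.** For EVERY genuine Θ-volume datum `T` at `(ratPoint (73/5973865915867209), 73)` ([IUTchIV] Cor. 2.2 (ii) proof (P7)) and EVERY pair of Θ- and q-ideles realising the pilot divisors of `X := pilotDataOfK T.D T.K`, abc-iut-c312-1's `Thm311ToCor312.Licence` HOLDS at abc-iut-c312-7's `settingPrVolSharp X …`. NO local-type and NO conjugacy hypothesis: the bad primes are `3, 7, 103, 127, 941` (`WRow.bad_prime_frey73`); the bad completions over each are isometrically `ℚ_p`-isomorphic (`d_mod = 1`), so the ramification index is a single unknown `e_p` per prime with `e_3 ∈ 2190·ℕ` (wild) and `e_{7} ∈ 1»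
[cite: Mochizuki2012, IUTchIII Cor. 3.12 Step (xi-f) p. 184; IUTchIV Prop. 1.2 (i)(ii) p. 10, Cor. 2.2 (ii) proof (P5) p. 46]
[cite: DupuyHilado2025, §3.3, §3.4, §4.9, §4.12] [claim: Mochizuki2012, status: disputed] -/
theorem WRowM.licence_frey73_l73_unconditional_M (T : Cor22.ThetaVolumeDatumAt (ratPoint (((73 : ℕ) : ℚ) / (5973865915867209 : ℕ))) 73) :
    letI := T.instFieldF; letI := T.instNumberFieldF; letI := T.instAlgebraF; letI := T.instFieldK
    letI := T.instNumberFieldK; letI := T.instAlgebraK; letI := T.instFieldFbar; letI := T.instAlgebraFbar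
    letI := T.instAlgebraKFbar; letI := T.instIsElliptic
    ∀ {logvK : PadicLogsVal T.K} (hlog : LogvAnalyticVal logvK) (r : ThetaData.IdeleData T.D) (M : Type) [Field M] [NumberField M]
      (archPk : ∀ (j : (thetaIndexOfInitial T.D).Label) (vQ : (thetaIndexOfInitial T.D).VQ),
        Set ((logShellsOfInitialDH T.D logvK).Packet j vQ))
      (archSub : ∀ (j : (thetaIndexOfInitial T.D).Label) (v : (thetaIndexOfInitial T.D).V),
        Set ((logShellsOfInitialDH T.D logvK).Packet j ((thetaIndexOfInitial T.D).over v)))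
      (Ψ : ℤ → ∀ v : (thetaIndexOfInitial T.D).V, v ∈ (thetaIndexOfInitial T.D).Vbad →
        Set ((logShellsOfInitialDH T.D logvK).StarPacket v))
      (act : ℤ → ∀ v : (thetaIndexOfInitial T.D).V, v ∈ (thetaIndexOfInitial T.D).Vbad →
        (logShellsOfInitialDH T.D logvK).StarPacket v → Module.End ℚ ((logShellsOfInitialDH T.D logvK).StarPacket v))
      (Mmod : ℤ → ∀ j : (thetaIndexOfInitial T.D).LabelStar, Set ((logShellsOfInitialDH T.D logvK).GlobalPacket j.1))
      (region : ℤ → ∀ j : (thetaIndexOfInitial T.D).LabelStar, FinDivisor M → ∀ vQ : (thetaIndexOfInitial T.D).VQ,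
        Set ((logShellsOfInitialDH T.D logvK).Packet j.1 vQ))
      (n : ℤ) {HT : Type} {LogLink : HT → HT → Type} {IsFull : ∀ {s t : HT}, LogLink s t → Prop}
      (lat : LGPGaussianLogThetaLattice LogLink IsFull)
      {Frd : Type} {IsoF : Frd → Frd → Type} {Ob : Frd → Type} {realify : Frd → Frd} {Strip : Type}
      {IsoS : Strip → Strip → Type}
      {Mv : ∀ v : (thetaIndexOfInitial T.D).V, v ∈ (thetaIndexOfInitial T.D).Vbad → Type} [∀ v h, Monoid (Mv v h)]
      (sig : GlobalLGPFrobenioidSignature (thetaIndexOfInitial T.D).lstar (thetaIndexOfInitial T.D).V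
        (· ∈ (thetaIndexOfInitial T.D).Vbad) Frd IsoF Ob realify Strip IsoS Mv)
      (split : SplittingMonoids Mv) {ObΔ : Type}
      {N : ∀ v : (thetaIndexOfInitial T.D).V, v ∈ (thetaIndexOfInitial T.D).Vbad → Type} [∀ v h, Monoid (N v h)]
      (qData : QPilotData ObΔ N)
      (htq0 : ∀ (u : FinitePlace ℚ) (x : (thetaIndexOfInitial T.D).Fibre (Val.non u)),
        tqM T.D (ratChar u) u (natCast_ratChar_mem u) r x ≠ 0)
      (Sq : Finset (FinitePlace ℚ))
      (htq1 : ∀ (u : FinitePlace ℚ) (x : (thetaIndexOfInitial T.D).Fibre (Val.non u)), u ∉ Sq →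
        ‖tqM T.D (ratChar u) u (natCast_ratChar_mem u) r x‖ = 1),
      Thm311ToCor312.Licence
        (settingPrVolSharpM T.D hlog (tOfIdeleData T.D r) (fun u x => tqM T.D (ratChar u) u (natCast_ratChar_mem u) r x) M archPk
          archSub Ψ act Mmod region n lat sig split qData htq0 Sq htq1) := by
  classical
  letI := T.instFieldF; letI := T.instNumberFieldF; letI := T.instAlgebraF; letI := T.instFieldK
  letI := T.instNumberFieldK; letI := T.instAlgebraK; letI := T.instFieldFbar; letI := T.instAlgebraFbar
  letI := T.instAlgebraKFbar; letI := T.instIsElliptic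
  intro logvK hlog r M _ _ archPk archSub Ψ act Mmod region n HT LogLink IsFull lat Frd IsoF Ob realify Strip IsoS Mv _ sig split ObΔ N _
    qData htq0 Sq htq1
  have hjF : T.E.j = ((jInv (((73 : ℕ) : ℚ) / (5973865915867209 : ℕ)) : ℚ) : T.F) := by rw [T.j_eq]; exact eq_ratCast _ _
  have hlstar : (pilotDataOfK T.D T.K).lstar = 36 := by
    show ((pilotDataOfK T.D T.K).l - 1) / 2 = 36
    rw [pilotDataOfK_l]
  -- `d_mod = 1`: conjugate, isometric bad fibres
  have hFm : Module.finrank ℚ (fieldOfModuli T.E) = 1 := by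
    rw [T.finrank_rat_fieldOfModuli_eq_dmod]
    exact dmod_eq_one_of_degree_le_one (by rw [degree_ratPoint])
  -- the per-prime data (e, D, h, ρin, ρout): `e` is the ACTUAL (unknown) index at some bad fibre point
  set eF : Nat.Primes → ℕ := fun pp =>
    haveI : Fact (pp : ℕ).Prime := ⟨pp.2⟩
    if h : ∃ x : (thetaIndex (pilotDataOfK T.D T.K)).Fibre (.inr pp), placeOf (pilotDataOfK T.D T.K) pp.1 x ∈ (pilotDataOfK T.D T.K).S
    then absRamificationIdx (pp : ℕ) (kOf (pilotDataOfK T.D T.K) pp.1 h.choose) else 1 with heF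
  set DF : Nat.Primes → ℕ := fun pp => if (pp : ℕ) = 3 then 2 * eF pp - 1 else
      eF pp - 1 with hDF
  set hF : Nat.Primes → ℕ := fun pp => if (pp : ℕ) = 2 then 26 else if (pp : ℕ) = 3 then 32 else if (pp : ℕ) = 7 then 14 else
      if (pp : ℕ) = 73 then 2 else if (pp : ℕ) = 103 then 6 else if (pp : ℕ) = 127 then 2 else 4 with hhF
  set rinF : Nat.Primes → ℤ := fun pp => if (pp : ℕ) = 3 then ((eF pp / 2 : ℕ) : ℤ) else
      1 with hrinF
  set routF : Nat.Primes → ℤ := fun pp => if (pp : ℕ) = 3 then min ((3 : ℤ) ^ 7 - 7 * (eF pp : ℤ)) ((3 : ℤ) ^ 8 - 8 * (eF pp : ℤ)) else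
      if (pp : ℕ) = 7 then min ((7 : ℤ) ^ 3 - 3 * (eF pp : ℤ)) ((7 : ℤ) ^ 4 - 4 * (eF pp : ℤ)) else
      if (pp : ℕ) = 103 then min ((103 : ℤ) ^ 1 - 1 * (eF pp : ℤ)) ((103 : ℤ) ^ 2 - 2 * (eF pp : ℤ)) else
      if (pp : ℕ) = 127 then min ((127 : ℤ) ^ 1 - 1 * (eF pp : ℤ)) ((127 : ℤ) ^ 2 - 2 * (eF pp : ℤ)) else
      min ((941 : ℤ) ^ 1 - 1 * (eF pp : ℤ)) ((941 : ℤ) ^ 2 - 2 * (eF pp : ℤ)) with hroutF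
  -- at a bad fibre point `x | p`: `e(K_x) = eF p`
  have heq : ∀ (pp : Nat.Primes) (x : (thetaIndex (pilotDataOfK T.D T.K)).Fibre (.inr pp)),
      haveI : Fact (pp : ℕ).Prime := ⟨pp.2⟩
      placeOf (pilotDataOfK T.D T.K) pp.1 x ∈ (pilotDataOfK T.D T.K).S →
        absRamificationIdx (pp : ℕ) (kOf (pilotDataOfK T.D T.K) pp.1 x) = eF pp := by
    intro pp x hx
    haveI : Fact (pp : ℕ).Prime := ⟨pp.2⟩
    have hex : ∃ x : (thetaIndex (pilotDataOfK T.D T.K)).Fibre (.inr pp),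
        placeOf (pilotDataOfK T.D T.K) pp.1 x ∈ (pilotDataOfK T.D T.K).S := ⟨x, hx⟩
    have h1 : eF pp = absRamificationIdx (pp : ℕ) (kOf (pilotDataOfK T.D T.K) pp.1 hex.choose) := by
      simp only [heF, dif_pos hex]
    rw [h1]
    exact WRow.absRamificationIdx_kOf_eq_of_finrank_eq_one T.D hFm pp x hex.choose
  -- the admissible shape of `e` at each bad prime: `e = e₀·m`, `m ≥ 1`, and `73 ∣ e`
  have hshape : ∀ (pp : Nat.Primes) (x : (thetaIndex (pilotDataOfK T.D T.K)).Fibre (.inr pp)),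
      haveI : Fact (pp : ℕ).Prime := ⟨pp.2⟩
      placeOf (pilotDataOfK T.D T.K) pp.1 x ∈ (pilotDataOfK T.D T.K).S →
        73 ∣ eF pp ∧ ∃ m : ℕ, 1 ≤ m ∧ eF pp = (if (pp : ℕ) = 3 then 2190 else if (pp : ℕ) = 7 then 1095 else
          if (pp : ℕ) = 103 then 365 else
          if (pp : ℕ) = 127 then 1095 else
          1095) * m := by
    intro pp x hx
    haveI : Fact (pp : ℕ).Prime := ⟨pp.2⟩
    have hE := heq pp x hx
    have hpos := absRamificationIdx_pos (pp : ℕ) (kOf (pilotDataOfK T.D T.K) pp.1 x)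
    obtain ⟨hpl, hcases⟩ := WRow.bad_prime_frey73 T pp x hx
    have hd := WRow.dvd_absRamificationIdx_frey73 T pp hpl x
    rw [hE] at hpos hd
    rcases hcases with ⟨hp, -⟩ | ⟨hp, -⟩ | ⟨hp, -⟩ | ⟨hp, -⟩ | ⟨hp, -⟩ | ⟨hp, -⟩
    · simp only [hp] at hd ⊢
      norm_num at hd ⊢
      refine ⟨by omega, eF pp / 2190, by omega, by omega⟩
    · simp only [hp] at hd ⊢
      norm_num at hd ⊢
      refine ⟨by omega, eF pp / 1095, by omega, by omega⟩
    · exact absurd hp hpl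
    · simp only [hp] at hd ⊢
      norm_num at hd ⊢
      refine ⟨by omega, eF pp / 365, by omega, by omega⟩
    · simp only [hp] at hd ⊢
      norm_num at hd ⊢
      refine ⟨by omega, eF pp / 1095, by omega, by omega⟩
    · simp only [hp] at hd ⊢
      norm_num at hd ⊢
      refine ⟨by omega, eF pp / 1095, by omega, by omega⟩
  refine WRowM.licence_tOfIdeleData_of_ordersK_rat T.D hlog r M archPk archSub Ψ act Mmod region n lat sig split qData htq0 Sq
    htq1 (jInv (((73 : ℕ) : ℚ) / (5973865915867209 : ℕ))) hjF eF DF hF rinF routF (fun pp x hx => ?_) (fun pp hpp i => ?_)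
  · -- the local packages at a bad place `x | p`
    haveI : Fact (pp : ℕ).Prime := ⟨pp.2⟩
    have hE := heq pp x hx
    obtain ⟨hl, m, hm1, hm⟩ := hshape pp x hx
    obtain ⟨hpl, hcases⟩ := WRow.bad_prime_frey73 T pp x hx
    have hne : ∀ c : ℕ, (eF pp : ℤ) ≠ (((pp : ℕ) : ℕ) : ℤ) ^ c * ((((pp : ℕ) : ℕ) : ℤ) - 1) := by
      refine WRow.natCast_ne_pow_mul_sub_one (by norm_num : Nat.Prime 73) pp.2 (fun h => hpl h.symm) (fun h => ?_) hl
      rcases hcases with ⟨hp, -⟩ | ⟨hp, -⟩ | ⟨hp, -⟩ | ⟨hp, -⟩ | ⟨hp, -⟩ | ⟨hp, -⟩ <;> simp only [hp] at h <;> omega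
    rcases hcases with ⟨hp, hord⟩ | ⟨hp, hord⟩ | ⟨hp, hord⟩ | ⟨hp, hord⟩ | ⟨hp, hord⟩ | ⟨hp, hord⟩
    · -- `p = 3`: `e = 2190·m`
      simp only [hp] at hm; norm_num at hm
      have h3 : hF pp = 32 := by simp [hhF, hp]
      refine ⟨hE, ?_, ?_, ?_, by rw [h3]; simpa using hord, by rw [h3, hm]; omega⟩
      · have hd := GenuineK.sub_one_div_le_differentOrd_kOf_wild_ratPoint T pp (by rw [hp]; norm_num) (by rw [hp]; norm_num)
          (t := 16) (by norm_num) (by rw [hp]; norm_num)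
          (fun v hv => by rw [WRow.ord_jInv_frey73 v hv (by rw [hp]; norm_num), hp]; norm_num) x
        rw [hE] at hd
        rw [show DF pp = 2 * eF pp - 1 by simp [hDF, hp]]
        exact hd
      · exact WRow.inner_witness_slot (pp : ℕ) (by rw [hp]; norm_num) hE (show rinF pp = _ by simp [hrinF, hp])
      · exact WRow.outer_member_min (pp : ℕ) hE hne 7 8 (show (((pp : ℕ) : ℕ) : ℤ) = 3 by exact_mod_cast hp)
          (by simp [hroutF, hp])
    · -- `p = 7`: `e = 1095·m`
      simp only [hp] at hm; norm_num at hm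
      have h3 : hF pp = 14 := by simp [hhF, hp]
      refine ⟨hE, ?_, ?_, ?_, by rw [h3]; simpa using hord, by rw [h3, hm]; omega⟩
      · rw [show DF pp = eF pp - 1 by simp [hDF, hp]]
        exact Cor312Prov.pred_div_le_differentOrd_of_eq (pp : ℕ) hE
      · rw [show rinF pp = 1 by simp [hrinF, hp]]
        exact WRow.inner_witness_trivial (pp : ℕ) _ (eF pp)
      · exact WRow.outer_member_min (pp : ℕ) hE hne 3 4 (show (((pp : ℕ) : ℕ) : ℤ) = 7 by exact_mod_cast hp)
          (by simp [hroutF, hp])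
    · exact absurd hp hpl
    · -- `p = 103`: `e = 365·m`
      simp only [hp] at hm; norm_num at hm
      have h3 : hF pp = 6 := by simp [hhF, hp]
      refine ⟨hE, ?_, ?_, ?_, by rw [h3]; simpa using hord, by rw [h3, hm]; omega⟩
      · rw [show DF pp = eF pp - 1 by simp [hDF, hp]]
        exact Cor312Prov.pred_div_le_differentOrd_of_eq (pp : ℕ) hE
      · rw [show rinF pp = 1 by simp [hrinF, hp]]
        exact WRow.inner_witness_trivial (pp : ℕ) _ (eF pp)
      · exact WRow.outer_member_min (pp : ℕ) hE hne 1 2 (show (((pp : ℕ) : ℕ) : ℤ) = 103 by exact_mod_cast hp)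
          (by simp [hroutF, hp])
    · -- `p = 127`: `e = 1095·m`
      simp only [hp] at hm; norm_num at hm
      have h3 : hF pp = 2 := by simp [hhF, hp]
      refine ⟨hE, ?_, ?_, ?_, by rw [h3]; simpa using hord, by rw [h3, hm]; omega⟩
      · rw [show DF pp = eF pp - 1 by simp [hDF, hp]]
        exact Cor312Prov.pred_div_le_differentOrd_of_eq (pp : ℕ) hE
      · rw [show rinF pp = 1 by simp [hrinF, hp]]
        exact WRow.inner_witness_trivial (pp : ℕ) _ (eF pp)
      · exact WRow.outer_member_min (pp : ℕ) hE hne 1 2 (show (((pp : ℕ) : ℕ) : ℤ) = 127 by exact_mod_cast hp)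
          (by simp [hroutF, hp])
    · -- `p = 941`: `e = 1095·m`
      simp only [hp] at hm; norm_num at hm
      have h3 : hF pp = 4 := by simp [hhF, hp]
      refine ⟨hE, ?_, ?_, ?_, by rw [h3]; simpa using hord, by rw [h3, hm]; omega⟩
      · rw [show DF pp = eF pp - 1 by simp [hDF, hp]]
        exact Cor312Prov.pred_div_le_differentOrd_of_eq (pp : ℕ) hE
      · rw [show rinF pp = 1 by simp [hrinF, hp]]
        exact WRow.inner_witness_trivial (pp : ℕ) _ (eF pp)
      · exact WRow.outer_member_min (pp : ℕ) hE hne 1 2 (show (((pp : ℕ) : ℕ) : ℤ) = 941 by exact_mod_cast hp)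
          (by simp [hroutF, hp])
  · -- the integer cells at every label `j = i + 1 ≤ 36`
    haveI : Fact (pp : ℕ).Prime := ⟨pp.2⟩
    obtain ⟨x, hx⟩ := hpp
    have hi : (i : ℕ) < 36 := hlstar ▸ i.isLt
    generalize hk : (i : ℕ) = k at hi ⊢
    obtain ⟨-, m, hm1, hm⟩ := hshape pp x hx
    obtain ⟨hpl, hcases⟩ := WRow.bad_prime_frey73 T pp x hx
    rcases hcases with ⟨hp, -⟩ | ⟨hp, -⟩ | ⟨hp, -⟩ | ⟨hp, -⟩ | ⟨hp, -⟩ | ⟨hp, -⟩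
    · simp only [hp] at hm; norm_num at hm
      have h2 : DF pp = 2 * (2190 * m) - 1 := by simp [hDF, hp, hm]
      have h3 : hF pp = 32 := by simp [hhF, hp]
      have h4 : rinF pp = (((2190 * m / 2 : ℕ) : ℤ)) := by simp [hrinF, hp, hm]
      have h5 : routF pp = min ((3 : ℤ) ^ 7 - 7 * (eF pp : ℤ)) ((3 : ℤ) ^ 8 - 8 * (eF pp : ℤ)) := by
        simp [hroutF, hp]
      rw [h2, h3, h4, h5, hm]
      exact WRow.ucell_frey73_l73_p3 hm1 k hi
    · simp only [hp] at hm; norm_num at hm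
      have h2 : DF pp = 1095 * m - 1 := by simp [hDF, hp, hm]
      have h3 : hF pp = 14 := by simp [hhF, hp]
      have h4 : rinF pp = (1 : ℤ) := by simp [hrinF, hp]
      have h5 : routF pp = min ((7 : ℤ) ^ 3 - 3 * (eF pp : ℤ)) ((7 : ℤ) ^ 4 - 4 * (eF pp : ℤ)) := by
        simp [hroutF, hp]
      rw [h2, h3, h4, h5, hm]
      exact WRow.ucell_frey73_l73_p7 hm1 k hi
    · exact absurd hp hpl
    · simp only [hp] at hm; norm_num at hm
      have h2 : DF pp = 365 * m - 1 := by simp [hDF, hp, hm]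
      have h3 : hF pp = 6 := by simp [hhF, hp]
      have h4 : rinF pp = (1 : ℤ) := by simp [hrinF, hp]
      have h5 : routF pp = min ((103 : ℤ) ^ 1 - 1 * (eF pp : ℤ)) ((103 : ℤ) ^ 2 - 2 * (eF pp : ℤ)) := by
        simp [hroutF, hp]
      rw [h2, h3, h4, h5, hm]
      exact WRow.ucell_frey73_l73_p103 hm1 k hi
    · simp only [hp] at hm; norm_num at hm
      have h2 : DF pp = 1095 * m - 1 := by simp [hDF, hp, hm]
      have h3 : hF pp = 2 := by simp [hhF, hp]
      have h4 : rinF pp = (1 : ℤ) := by simp [hrinF, hp]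
      have h5 : routF pp = min ((127 : ℤ) ^ 1 - 1 * (eF pp : ℤ)) ((127 : ℤ) ^ 2 - 2 * (eF pp : ℤ)) := by
        simp [hroutF, hp]
      rw [h2, h3, h4, h5, hm]
      exact WRow.ucell_frey73_l73_p127 hm1 k hi
    · simp only [hp] at hm; norm_num at hm
      have h2 : DF pp = 1095 * m - 1 := by simp [hDF, hp, hm]
      have h3 : hF pp = 4 := by simp [hhF, hp]
      have h4 : rinF pp = (1 : ℤ) := by simp [hrinF, hp]
      have h5 : routF pp = min ((941 : ℤ) ^ 1 - 1 * (eF pp : ℤ)) ((941 : ℤ) ^ 2 - 2 * (eF pp : ℤ)) := by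
        simp [hroutF, hp]
      rw [h2, h3, h4, h5, hm]
      exact WRow.ucell_frey73_l73_p941 hm1 k hi

end Summit.ABC.IUTFork.Conditional

end
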